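import Mathlib.Analysis.ODE.ExistUnique
import Literature.Topology.FourManifolds.InvertedGermExtension
import Literature.Topology.FourManifolds.MMSWFibreRotation
import Summits.SmoothPoincare4.SmoothPoincare4.Theorems.DottedCircleRasmussenDcrGapStubFriendsH2HF3

/-!
# Helper `helper_handlebodyChart_modelHandles` (M3: handle structure of the model dotted handlebody `D_k`)
# of line `mk_friends` for crux `DcrGap` — collar push, part 1: tools
(item stmt-SmoothPoincare4-16128, route route-SmoothPoincare4-DottedCircleRasmussen)

The model lemma M3 of stub `stub_handlebodyChart` (registered helper
`helper_handlebodyChart_modelHandles`) asks, for every open `U ⊇ D_k = MMSW.modelHandlebody k`, for a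
diffeomorphism of `ℝ⁴` supported in `U` squeezing `D_k` into a base ball and `k` handle tubes, compatibly
with the fibre twists.  Its first stage is a **collar push**: a diffeomorphism supported in `U` carrying
`D_k` into the fixed compact part `D_k ∩ {G_k ≤ 24/25}` of its interior, after which all further squeezes
can be supported inside `D_k` itself.  This file holds the tools of that stage (the push is in the sibling
file `…ModelHandlesCollar.lean`):

* `ModelHandles.exists_flow_package` — the smooth global flow of a compactly supported smooth field on a
  finite-dimensional space (Lee 2012, Thm. 9.16, the tree's
  `Literature.Geometry.Manifold.exists_contDiff_globalFlow`), with every stage a diffeomorphism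
  (`diffeomorphOfContDiffBijective`) and **equivariance**: a continuous linear map commuting with the
  field commutes with the flow (uniqueness for Lipschitz ODEs, `ODE_solution_unique_univ`; a compactly
  supported `C^∞` field is Lipschitz, `ModelHandles.exists_lipschitzWith_of_contDiff`);
* `ModelHandles.collarCutoff_*` — the cutoff `φ_m(g) = χ(200(g - 191/200)) χ((1 + 2m - g)/m)`,
  equal to `1` on `[24/25, 1 + m]` and supported in `(191/200, 1 + 2m)`;
* `ModelHandles.exists_band_subset` — for `U ⊇ D_k` open, some band `{guard ≥ 1/2, G_k ≤ 1 + 2m}` lies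
  in `U` (compactness: these bands decrease to `D_k`);
* `ModelHandles.exists_clm_fibreRot_const` — the rotations `(z, w) ↦ (z, u w)` of the `w`-plane are
  linear.

Everything is proved; no definitions, no named facts.

References: J. M. Lee, *Introduction to Smooth Manifolds*, 2nd ed. (2012), Thm. 9.12, Thm. 9.16
[LeeSmoothManifolds2013]; J. Milnor, *Morse Theory* (1963), Thm. 3.1 [Milnor1963].
-/

-- the prescribed namespace `Summit.<P>.<Sub>.…` duplicates `SmoothPoincare4` (P = Sub)
set_option linter.dupNamespace false

noncomputable section

open scoped Manifold ContDiff Topology NNReal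
open Function Set Metric Filter
open Literature.Topology.FourManifolds Literature.Topology.FourManifolds.MMSW
open Literature.AlgebraicTopology.Homotopy.HopfFibration

namespace Summit.SmoothPoincare4.SmoothPoincare4.Theorems.DcrGap.MkFriends

namespace ModelHandles

/-! ## Flows of compactly supported fields on a finite-dimensional space -/

section Flow

variable {F : Type*} [NormedAddCommGroup F] [NormedSpace ℝ F]

/-- A `C^∞` vector field vanishing off a compact set is Lipschitz (bounded derivative and the mean
value inequality). [folklore] -/
theorem exists_lipschitzWith_of_contDiff {V : F → F} (hV : ContDiff ℝ ∞ V) {K : Set F}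
    (hK : IsCompact K) (hVK : ∀ x, x ∉ K → V x = 0) : ∃ C : ℝ≥0, LipschitzWith C V := by
  have hsupp : HasCompactSupport V := HasCompactSupport.intro hK hVK
  have hdiff : Differentiable ℝ V := hV.differentiable (by simp)
  have hcont : Continuous (fderiv ℝ V) := hV.continuous_fderiv (by simp)
  have hsupp' : HasCompactSupport (fderiv ℝ V) := hsupp.fderiv ℝ
  obtain ⟨C, hC⟩ := (hcont.norm).bddAbove_range_of_hasCompactSupport hsupp'.norm
  refine ⟨⟨max C 0, le_max_right _ _⟩, lipschitzWith_of_nnnorm_fderiv_le hdiff fun x => ?_⟩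
  have h : ‖fderiv ℝ V x‖ ≤ C := hC (mem_range_self x)
  change ‖fderiv ℝ V x‖ ≤ max C 0
  exact h.trans (le_max_left _ _)

/-- **Equivariance of flows**: a continuous linear map commuting with a compactly supported
smooth field commutes with every curve of its flow (uniqueness of solutions of a Lipschitz ODE,
`ODE_solution_unique_univ`). [folklore] -/
theorem flow_comm_of_comm {V : F → F} (hV : ContDiff ℝ ∞ V) {K : Set F}
    (hK : IsCompact K) (hVK : ∀ x, x ∉ K → V x = 0) {θ : ℝ × F → F}
    (h0 : ∀ x, θ (0, x) = x)
    (hint : ∀ x t, HasDerivAt (fun t => θ (t, x)) (V (θ (t, x))) t)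
    (L : F →L[ℝ] F) (hL : ∀ x, V (L x) = L (V x)) (t : ℝ) (x : F) :
    θ (t, L x) = L (θ (t, x)) := by
  obtain ⟨C, hC⟩ := exists_lipschitzWith_of_contDiff hV hK hVK
  have key : (fun t => θ (t, L x)) = fun t => L (θ (t, x)) := by
    refine ODE_solution_unique_univ (v := fun _ => V) (s := fun _ => univ) (t₀ := 0)
      (fun _ => hC.lipschitzOnWith) (fun s => ⟨hint (L x) s, mem_univ _⟩)
      (fun s => ⟨?_, mem_univ _⟩) (by simp [h0])
    have h := (L.hasFDerivAt).comp_hasDerivAt s (hint x s)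
    simpa [Function.comp_def, hL] using h
  exact congrFun key t

variable [FiniteDimensional ℝ F]

/-- **The flow package of a compactly supported smooth field on a finite-dimensional space**: a
smooth global flow (Lee 2012, Thm. 9.16: `Literature.Geometry.Manifold.exists_contDiff_globalFlow`)
with its group law, flow equation, fixed zeros and support, whose every stage is a diffeomorphism
(smooth bijection with injective differential, `diffeomorphOfContDiffBijective`), and which commutes
with every continuous linear map commuting with the field. [cite: LeeSmoothManifolds2013, Thm. 9.12 and Thm. 9.16] -/
theorem exists_flow_package {V : F → F} (hV : ContDiff ℝ ∞ V) {K : Set F}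
    (hK : IsCompact K) (hVK : ∀ x, x ∉ K → V x = 0) :
    ∃ θ : ℝ × F → F, ContDiff ℝ ∞ θ ∧ (∀ x, θ (0, x) = x) ∧
      (∀ t s x, θ (t, θ (s, x)) = θ (t + s, x)) ∧
      (∀ x t, HasDerivAt (fun t => θ (t, x)) (V (θ (t, x))) t) ∧
      (∀ x, V x = 0 → ∀ t, θ (t, x) = x) ∧
      (∀ x, x ∉ K → ∀ t, θ (t, x) = x) ∧
      (∀ s, ∃ Φ : F ≃ₘ⟮𝓘(ℝ, F), 𝓘(ℝ, F)⟯ F, ∀ x, Φ x = θ (s, x)) ∧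
      ∀ L : F →L[ℝ] F, (∀ x, V (L x) = L (V x)) → ∀ t x, θ (t, L x) = L (θ (t, x)) := by
  haveI : CompleteSpace F := FiniteDimensional.complete ℝ F
  obtain ⟨θ, hθ, h0, hadd, hint, hfix⟩ :=
    Literature.Geometry.Manifold.exists_contDiff_globalFlow hV hK hVK
  refine ⟨θ, hθ, h0, hadd, hint, hfix, fun x hx => hfix x (hVK x hx), fun s => ?_,
    fun L hL t x => flow_comm_of_comm hV hK hVK h0 hint L hL t x⟩
  have hs : ContDiff ℝ ∞ fun x => θ (s, x) := hθ.comp (contDiff_const.prodMk contDiff_id)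
  have hinj : Injective fun x => θ (s, x) := by
    intro x x' h
    have := congrArg (fun y => θ (-s, y)) h
    simpa [hadd, h0] using this
  have hsurj : Surjective fun x => θ (s, x) := fun y => ⟨θ (-s, y), by simp [hadd, h0]⟩
  have hd : ∀ x, Injective (fderiv ℝ (fun x => θ (s, x)) x) := by
    intro x
    have hΦ : ∀ s, Differentiable ℝ (fun x => θ (s, x)) := fun s =>
      (hθ.comp (contDiff_const.prodMk contDiff_id)).differentiable (by simp)
    have hcomp : (fun x => θ (-s, x)) ∘ (fun x => θ (s, x)) = id := by
      funext x; simp [hadd, h0]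
    have hchain := fderiv_comp x (hΦ (-s) _) (hΦ s x)
    rw [hcomp, fderiv_id] at hchain
    refine Function.LeftInverse.injective (g := fderiv ℝ (fun x => θ (-s, x)) (θ (s, x))) fun v => ?_
    have := congrArg (fun L : F →L[ℝ] F => L v) hchain
    simpa using this.symm
  exact ⟨Literature.Topology.FourManifolds.diffeomorphOfContDiffBijective _ hs ⟨hinj, hsurj⟩ hd,
    fun x => rfl⟩

end Flow

/-! ## The cutoff of the collar push -/

/-- The cutoff `φ_m(g) = χ(200 (g - 191/200)) · χ((1 + 2m - g)/m)` (`χ = Real.smoothTransition`)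
is smooth. [folklore] -/
theorem collarCutoff_contDiff (m : ℝ) :
    ContDiff ℝ ∞ (fun g : ℝ => Real.smoothTransition (200 * (g - 191 / 200)) *
      Real.smoothTransition ((1 + 2 * m - g) / m)) := by
  refine ContDiff.mul ?_ ?_
  · exact Real.smoothTransition.contDiff.comp (contDiff_const.mul (contDiff_id.sub contDiff_const))
  · exact Real.smoothTransition.contDiff.comp ((contDiff_const.sub contDiff_id).div_const _)

/-- The cutoff takes values in `[0, 1]`. [folklore] -/
theorem collarCutoff_mem_Icc (m g : ℝ) :
    0 ≤ Real.smoothTransition (200 * (g - 191 / 200)) * Real.smoothTransition ((1 + 2 * m - g) / m) ∧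
      Real.smoothTransition (200 * (g - 191 / 200)) * Real.smoothTransition ((1 + 2 * m - g) / m) ≤ 1 :=
  ⟨mul_nonneg (Real.smoothTransition.nonneg _) (Real.smoothTransition.nonneg _),
    mul_le_one₀ (Real.smoothTransition.le_one _) (Real.smoothTransition.nonneg _)
      (Real.smoothTransition.le_one _)⟩

/-- The cutoff is `1` on the band `24/25 ≤ g ≤ 1 + m` (`m > 0`). [folklore] -/
theorem collarCutoff_eq_one {m g : ℝ} (hm : 0 < m) (h1 : 24 / 25 ≤ g) (h2 : g ≤ 1 + m) :
    Real.smoothTransition (200 * (g - 191 / 200)) * Real.smoothTransition ((1 + 2 * m - g) / m) = 1 := by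
  rw [Real.smoothTransition.one_of_one_le (by linarith),
    Real.smoothTransition.one_of_one_le (by rw [le_div_iff₀ hm]; linarith), one_mul]

/-- Where the cutoff is nonzero, `191/200 < g < 1 + 2m` (`m > 0`). [folklore] -/
theorem collarCutoff_ne_zero {m g : ℝ} (hm : 0 < m)
    (h : Real.smoothTransition (200 * (g - 191 / 200)) * Real.smoothTransition ((1 + 2 * m - g) / m) ≠ 0) :
    191 / 200 < g ∧ g < 1 + 2 * m := by
  constructor
  · by_contra hle
    push Not at hle
    apply h
    rw [Real.smoothTransition.zero_of_nonpos (by linarith), zero_mul]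
  · by_contra hle
    push Not at hle
    apply h
    rw [Real.smoothTransition.zero_of_nonpos (div_nonpos_of_nonpos_of_nonneg (by linarith) hm.le),
      mul_zero]


/-! ## Choice of the outer margin -/

/-- **A closed `G_k`-neighbourhood of `D_k` inside `U`.**  For every open `U ⊇ D_k` some band
`{guard ≥ 1/2, G_k ≤ 1 + 2m}` (`0 < m ≤ 1/4`) lies in `U`: these compact sets decrease to `D_k`
as `m → 0` (a point in all of them has `G_k ≤ 1`, hence every hole term `≥ 1`). [folklore] -/
theorem exists_band_subset (k : ℕ) {U : Set (EuclideanSpace ℝ (Fin 4))} (hUo : IsOpen U)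
    (hDU : modelHandlebody k ⊆ U) :
    ∃ m : ℝ, 0 < m ∧ m ≤ 1 / 4 ∧
      {y : EuclideanSpace ℝ (Fin 4) | (∀ j : Fin k, (1 : ℝ) / 2 ≤ holeTerm k j y) ∧
        levelFun k y ≤ 1 + 2 * m} ⊆ U := by
  set Z : ℕ → Set (EuclideanSpace ℝ (Fin 4)) := fun n =>
    {y | ∀ j : Fin k, (1 : ℝ) / 2 ≤ holeTerm k j y} ∩
      levelFun k ⁻¹' Iic (1 + 2 * (1 / (4 * ((n : ℝ) + 1)))) with hZ
  have hZc : ∀ n, IsClosed (Z n) := fun n =>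
    (continuousOn_levelFun (by norm_num : (0 : ℝ) < 1 / 2)).preimage_isClosed_of_isClosed
      (isClosed_guard (1 / 2)) isClosed_Iic
  have hZanti : ∀ i j : ℕ, i ≤ j → Z j ⊆ Z i := by
    intro i j hij y hy
    refine ⟨hy.1, ?_⟩
    have h1 : (1 : ℝ) / (4 * ((j : ℝ) + 1)) ≤ 1 / (4 * ((i : ℝ) + 1)) := by
      apply one_div_le_one_div_of_le (by positivity)
      have : (i : ℝ) ≤ j := by exact_mod_cast hij
      linarith
    have h2 : levelFun k y ≤ 1 + 2 * (1 / (4 * ((j : ℝ) + 1))) := hy.2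
    show levelFun k y ≤ 1 + 2 * (1 / (4 * ((i : ℝ) + 1)))
    linarith
  have hZ0c : IsCompact (Z 0) := by
    refine Metric.isCompact_of_isClosed_isBounded (hZc 0) ?_
    refine (isBounded_closedBall (x := (0 : EuclideanSpace ℝ (Fin 4)))
      (r := 2 * (40 * ((k : ℝ) + 1)))).subset fun y hy => mem_closedBall_zero_iff.2 ?_
    have hpos : ∀ j, 0 < holeTerm k j y := fun j => lt_of_lt_of_le (by norm_num) (hy.1 j)
    have h := hy.2
    simp only [Nat.cast_zero, zero_add, mul_one, mem_preimage, mem_Iic] at h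
    have h1 := FriendsH2.norm_sq_le_levelFun hpos
    have hk : (0 : ℝ) ≤ k := k.cast_nonneg
    have hR : (40 : ℝ) ≤ 40 * ((k : ℝ) + 1) := by nlinarith
    have h5 : ‖y‖ ^ 2 ≤ (2 * (40 * ((k : ℝ) + 1))) ^ 2 := by
      have h2 : levelFun k y * ((40 * ((k : ℝ) + 1)) ^ 2 + 1) ≤
          (1 + 2 * (1 / 4)) * ((40 * ((k : ℝ) + 1)) ^ 2 + 1) :=
        mul_le_mul_of_nonneg_right h (by positivity)
      nlinarith [norm_nonneg y]
    exact le_of_pow_le_pow_left₀ two_ne_zero (by positivity) h5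
  -- the compact set `Z 0 ∖ U` misses `⋂ Z n = D_k`
  have hs : IsCompact (Z 0 \ U) := hZ0c.diff hUo
  have hst : (Z 0 \ U) ∩ ⋂ n, Z n = ∅ := by
    refine eq_empty_iff_forall_notMem.2 fun y hy => hy.1.2 (hDU ?_)
    have hall : ∀ n, y ∈ Z n := fun n => mem_iInter.1 hy.2 n
    have hg : ∀ j : Fin k, (1 : ℝ) / 2 ≤ holeTerm k j y := (hall 0).1
    have hpos : ∀ j, 0 < holeTerm k j y := fun j => lt_of_lt_of_le (by norm_num) (hg j)
    have hG1 : levelFun k y ≤ 1 := by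
      refine le_of_forall_pos_lt_add fun ε hε => ?_
      obtain ⟨n, hn⟩ := exists_nat_gt (1 / ε)
      have hn' : 2 * ((1 : ℝ) / (4 * ((n : ℝ) + 1))) < ε := by
        rw [div_lt_iff₀ hε] at hn
        have : 2 * ((1 : ℝ) / (4 * ((n : ℝ) + 1))) = 1 / (2 * ((n : ℝ) + 1)) := by
          field_simp; ring
        rw [this, div_lt_iff₀ (by positivity)]
        nlinarith
      have := (hall n).2
      simp only [mem_preimage, mem_Iic] at this
      linarith
    refine ⟨fun j => ?_, hG1⟩
    have h := ((FriendsH2.levelFun_bounds hpos).2.2 j).trans hG1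
    rwa [one_div_le (hpos j) one_pos, div_one] at h
  have hdir : Directed (· ⊇ ·) Z := directed_of_isDirected_le fun i j hij => hZanti i j hij
  obtain ⟨n, hn⟩ := hs.elim_directed_family_closed Z hZc hst hdir
  refine ⟨1 / (4 * ((n : ℝ) + 1)), by positivity, ?_, fun y hy => ?_⟩
  · apply one_div_le_one_div_of_le (by norm_num)
    have : (0 : ℝ) ≤ n := n.cast_nonneg
    linarith
  · have hyZ : y ∈ Z n := ⟨hy.1, hy.2⟩
    by_contra hyU
    have : y ∈ (Z 0 \ U) ∩ Z n := ⟨⟨hZanti 0 n (Nat.zero_le n) hyZ, hyU⟩, hyZ⟩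
    rw [hn] at this
    exact this

/-! ## The rotations of the `w`-plane as linear maps -/

/-- The fibre rotation by a constant multiplier `u` is a continuous linear map of `ℝ⁴`. [folklore] -/
theorem exists_clm_fibreRot_const (u : ℂ) :
    ∃ L : EuclideanSpace ℝ (Fin 4) →L[ℝ] EuclideanSpace ℝ (Fin 4), ∀ y, L y = fibreRot (fun _ => u) y := by
  refine ⟨LinearMap.toContinuousLinearMap
    { toFun := fun y => fibreRot (fun _ => u) y
      map_add' := fun y y' => ?_
      map_smul' := fun c y => ?_ }, fun y => rfl⟩
  · ext i
    fin_cases i <;> simp [fibreRot, zC, wC, Complex.mul_re, Complex.mul_im] <;> ring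
  · ext i
    fin_cases i <;> simp [fibreRot, zC, wC, Complex.mul_re, Complex.mul_im] <;> ring

end ModelHandles

/-- **Registered piece `helper_handlebodyChart_modelHandles_flowPackage` of the model lemma M3 (flows of
compactly supported fields on `ℝ⁴`)**: a compactly supported smooth field on `ℝ⁴` has a smooth global
flow with the group law and the flow equation, fixing the zeros of the field and every point off the
support, whose stages are diffeomorphisms of `ℝ⁴`, and which commutes with every continuous linear map
commuting with the field (`ModelHandles.exists_flow_package` on `ℝ⁴`; Lee 2012, Thm. 9.12, 9.16, and
uniqueness for Lipschitz ODEs). [cite: LeeSmoothManifolds2013, Thm. 9.12 and Thm. 9.16] -/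
theorem helper_handlebodyChart_modelHandles_flowPackage : ∀ (V : EuclideanSpace ℝ (Fin 4) → EuclideanSpace ℝ (Fin 4)), ContDiff ℝ ((⊤ : ℕ∞) : WithTop ℕ∞) V → ∀ (K : Set (EuclideanSpace ℝ (Fin 4))), IsCompact K → (∀ x, x ∉ K → V x = 0) → ∃ θ : ℝ × EuclideanSpace ℝ (Fin 4) → EuclideanSpace ℝ (Fin 4), ContDiff ℝ ((⊤ : ℕ∞) : WithTop ℕ∞) θ ∧ (∀ x, θ (0, x) = x) ∧ (∀ t s x, θ (t, θ (s, x)) = θ (t + s, x)) ∧ (∀ x t, HasDerivAt (fun t => θ (t, x)) (V (θ (t, x))) t) ∧ (∀ x, V x = 0 → ∀ t, θ (t, x) = x) ∧ (∀ x, x ∉ K → ∀ t, θ (t, x) = x) ∧ (∀ s, ∃ Φ : EuclideanSpace ℝ (Fin 4) ≃ₘ⟮𝓡 4, 𝓡 4⟯ EuclideanSpace ℝ (Fin 4), ∀ x, Φ x = θ (s, x)) ∧ ∀ L : EuclideanSpace ℝ (Fin 4) →L[ℝ] EuclideanSpace ℝ (Fin 4), (∀ x, V (L x) = L (V x)) →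 ∀ t x, θ (t, L x) = L (θ (t, x)) :=
  fun _ hV _ hK hVK => ModelHandles.exists_flow_package hV hK hVK

end Summit.SmoothPoincare4.SmoothPoincare4.Theorems.DcrGap.MkFriends

end
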